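import Summits.BirchSwinnertonDyer.BirchSwinnertonDyer.Theorems.UniversalToricDescentTwinAlgMuZeroAtThreeGoodOrd
import HarnessLib

/-!
# Route `UniversalToricDescent`: the RK-6 v3 item `TwinAlgMuZeroAtThree` (stmt-BirchSwinnertonDyer-24254)
# reduced to its research buckets — at every non-additive twin with `d_K` odd (B ∪ C), and at the KERNEL's
# twins (B_très ∪ C₀) from the kernel's own binders

Width prover `bsd-wall-utd-p1-w2` g6 (sequel of `UniversalToricDescentTwinAlgMuZeroAtThreeGoodOrd`, which
discharged bucket A = good-ordinary twins modulo print). Two RESTATE-ROBUST reductions (neither names the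
route decl `TwinAlgMuZeroAtThree`, whose text is due a coordinated 1:1 restate R1/R2 next generation —
director (367)/(368); the by-name glue `24254 ⟸ BCS ∧ B ∧ C ∧ EvenDisc` for the LIVE text is kept as a
sketch in HOME `bsd-wall-utd-p1/twinalgmu-split-utdp1w2g6/` rather than landed against a text about to move):

* §0 `exists_generator_norm_one_of_span_le_map_charIdeal` / `xac_exists_generator_norm_one_of_span_le` — the glue algebra of any
  split: `(L′) ⊆ Ch·R₀⟦T⟧` with `μ(L′) = 0` ⟹ `Ch·R₀⟦T⟧ = (g)` with `μ(g) = 0` (any prime, any `Λ`-module), so a bucket stub may be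
  typed Howard-shape («torsion ∧ one frame inside `Ch·R₀⟦T⟧` with `μ = 0`»).
* `twinAlgMu_of_not_addv_of_odd_of_buckets` — 24254's conclusion at EVERY non-additive twin with `d_K` odd
  from `BCSHowardDivisibilityInput ∧ BCSMuZeroInput` (bucket A) and the two research clauses B (multiplicative
  twins) and C (good-supersingular twins) — the content of restate candidate R1 minus its print part.
* `twinAlgMu_of_kernelTwin_of_yanZhu_of_twinMuZero` — at the KERNEL's twins (good-ordinary ∨ multiplicative
  très ramifié ∨ good-supersingular `a₃ = 0`, `d_K` odd: kernel⁵'s trichotomy after the resupplies) the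
  conclusion follows from the kernel's OWN binders `YanZhuMainConjectureInput` (∈ `ToricPrintedLeavesAtThree`)
  and `TwinMuZeroAtThree` plus the clauses B_très and C₀ = exactly the two buckets of restate candidate R2
  (pen pss3x g8 08:58:14Z), in kernel⁵'s `hB`/`hS0` binder order: the kernel-side certificate that R2
  suffices for kernel_rat⁺ (24256) once its good-ordinary branch calls the previous file's §4.

THEOREMS ONLY; `--supports stmt-BirchSwinnertonDyer-24254`. BSD is not proved by any of this.
-/

noncomputable section

open scoped Classical

set_option linter.dupNamespace false
set_option autoImplicit false

namespace Summit.BirchSwinnertonDyer.BirchSwinnertonDyer.Theorems.UniversalToricDescentTwinAlgMu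

open PowerSeries WeierstrassCurve NumberField IsDedekindDomain Field
  Literature.NumberTheory.EllipticCurves
  Literature.NumberTheory.EllipticCurves.ModularForms
  Literature.NumberTheory.EllipticCurves.Rank1Residual
  Summit.BirchSwinnertonDyer.Rank1Residual
  Summit.BirchSwinnertonDyer.Rank1Residual.X11b
  Summit.BirchSwinnertonDyer.Rank1Residual.X11b.Halves
  Summit.BirchSwinnertonDyer.BirchSwinnertonDyer.Theses.UniversalToricDescent

/-! ## §0 The glue algebra of any split of 24254: `torsion ∧ (L′) ⊆ Ch·R₀⟦T⟧ ∧ μ(L′) = 0 ⟹` the item's conclusion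

(The «algebra (S/M, elementary)» line of the pen's bucket map, `TWINALGMU-24254-PLANNING.md` §3: `Ch_Λ` is principal —
`charIdeal_isPrincipal_holds` —, its image generator divides `L′`, and a divisor of a series with a norm-one coefficient has one —
`exists_norm_coeff_eq_one_of_dvd` of the previous file. Any prime `p`, any `Λ`-module; then the `X_ac` reading.) -/

section GlueAlgebra

variable {p : ℕ} [Fact p.Prime]

/-- **An inclusion `(L) ⊆ Ch_Λ(M)·R₀⟦T⟧` with `μ(L) = 0` forces `Ch_Λ(M)·R₀⟦T⟧ = (g)` for some `g` with a norm-one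
coefficient** (any `Λ = ℤ_p⟦T⟧`-module `M`; `Ch_Λ(M)` is principal, Washington §13.2). [cite: Washington1997, §13.2] -/
theorem exists_generator_norm_one_of_span_le_map_charIdeal (M : Type*) [AddCommGroup M]
    [Module (IwasawaAlgebra p) M] {L : UnrSeries p}
    (hle : Ideal.span {L} ≤
      (Literature.NumberTheory.EllipticCurves.Module.charIdeal (IwasawaAlgebra p) M).map (PowerSeries.map (toUnr p)))
    (hL : ∃ i : ℕ, ‖((PowerSeries.coeff i L : unrIntegers p) : ℂ_[p])‖ = 1) :
    ∃ g : UnrSeries p,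
      (Literature.NumberTheory.EllipticCurves.Module.charIdeal (IwasawaAlgebra p) M).map (PowerSeries.map (toUnr p)) =
        Ideal.span {g} ∧
      ∃ i : ℕ, ‖((PowerSeries.coeff i g : unrIntegers p) : ℂ_[p])‖ = 1 := by
  obtain ⟨F, hF⟩ := (charIdeal_isPrincipal_holds p M).principal
  have hchar : Literature.NumberTheory.EllipticCurves.Module.charIdeal (IwasawaAlgebra p) M = Ideal.span {F} := hF
  refine ⟨PowerSeries.map (toUnr p) F, by rw [hchar, map_span_singleton_eq], ?_⟩
  rw [hchar, map_span_singleton_eq, Ideal.span_singleton_le_span_singleton] at hle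
  exact exists_norm_coeff_eq_one_of_dvd hle hL

/-- **The `X_ac` reading** (any curve over a number field, any prime, any imprimitivity set, any place): the second conjunct of
`TwinAlgMuZeroAtThree`'s conclusion from ONE frame `L′` with `(L′) ⊆ Ch_Λ(X_ac)·R₀⟦T⟧` and a norm-one coefficient — so a bucket stub
may conclude «torsion ∧ ∃ frame inside `Ch·R₀⟦T⟧` with `μ = 0`» (Howard-shape) and still close the item. [cite: Washington1997, §13.2] -/
theorem xac_exists_generator_norm_one_of_span_le {K : Type} [Field K] [NumberField K] (W : WeierstrassCurve K)
    (κ : ZpExtension K p) (𝔭 : HeightOneSpectrum (𝓞 K)) (S : Set (HeightOneSpectrum (𝓞 K))) (γ : absoluteGaloisGroup K)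
    [Fact (κ.IsTopGenerator γ)] {L : UnrSeries p}
    (hle : Ideal.span {L} ≤ (AcSelmer.XAc.charIdeal W p κ 𝔭 S γ).map (PowerSeries.map (toUnr p)))
    (hL : ∃ i : ℕ, ‖((PowerSeries.coeff i L : unrIntegers p) : ℂ_[p])‖ = 1) :
    ∃ g : UnrSeries p, (AcSelmer.XAc.charIdeal W p κ 𝔭 S γ).map (PowerSeries.map (toUnr p)) = Ideal.span {g} ∧
      ∃ i : ℕ, ‖((PowerSeries.coeff i g : unrIntegers p) : ℂ_[p])‖ = 1 :=
  exists_generator_norm_one_of_span_le_map_charIdeal (AcSelmer.XAc W p κ 𝔭 S γ) hle hL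

end GlueAlgebra

/-- **On the kernel's twins the parked even-`d_K` corner is never met and bucket A is print**: for `d_K`
ODD, `TwinAlgMuZeroAtThree`'s conclusion at a non-additive twin follows from BCS 2025 (bucket A) and the
two research clauses B, C alone. [cite: BurungaleCastellaSkinner2025, Thm. 4.2.1 (b) and Prop. 4.2.2 (§4.2, pp. 8–9 of arXiv:2405.00270v2)] -/
theorem twinAlgMu_of_not_addv_of_odd_of_buckets (h421 : BCSHowardDivisibilityInput) (h422 : BCSMuZeroInput)
    (hB : ∀ (W' : WeierstrassCurve ℚ) [W'.IsElliptic] [W'.IsGloballyMinimal] (N' : ℕ) [NeZero N']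
      (K : Type) [Field K] [NumberField K] (Dt' : ModularParametrizationData W' N'),
      Mult W' 3 → W'.HasSurjectiveModNGaloisRep 3 → W'.conductorNorm ℤ = N' → IsImaginaryQuadratic K →
      SatisfiesHeegnerHypothesis N' K → Odd (NumberField.discr K) →
      ∀ (κ : ZpExtension K 3), κ.IsAnticyclotomic → ∀ (γ : absoluteGaloisGroup K) [Fact (κ.IsTopGenerator γ)]
        (𝔭 : HeightOneSpectrum (𝓞 K)), ((3 : ℕ) : 𝓞 K) ∈ 𝔭.asIdeal →
        𝔭.asIdeal.ramificationIdx (𝓞 ℚ) = 1 → 𝔭.asIdeal.inertiaDeg (𝓞 ℚ) = 1 →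
        ∀ (𝔭' : HeightOneSpectrum (𝓞 K)), ((3 : ℕ) : 𝓞 K) ∈ 𝔭'.asIdeal → 𝔭' ≠ 𝔭 →
        Module.IsTorsion (IwasawaAlgebra 3) (AcSelmer.XAc (W'.baseChange K) 3 κ 𝔭' ∅ γ) ∧
          ∃ g' : UnrSeries 3,
            (AcSelmer.XAc.charIdeal (W'.baseChange K) 3 κ 𝔭' ∅ γ).map (PowerSeries.map (toUnr 3)) =
              Ideal.span {g'} ∧
            ∃ i : ℕ, ‖((PowerSeries.coeff i g' : unrIntegers 3) : ℂ_[3])‖ = 1)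
    (hC : ∀ (W' : WeierstrassCurve ℚ) [W'.IsElliptic] [W'.IsGloballyMinimal] (N' : ℕ) [NeZero N']
      (K : Type) [Field K] [NumberField K] (Dt' : ModularParametrizationData W' N'),
      GoodSS W' 3 → W'.HasSurjectiveModNGaloisRep 3 → W'.conductorNorm ℤ = N' → IsImaginaryQuadratic K →
      SatisfiesHeegnerHypothesis N' K → Odd (NumberField.discr K) →
      ∀ (κ : ZpExtension K 3), κ.IsAnticyclotomic → ∀ (γ : absoluteGaloisGroup K) [Fact (κ.IsTopGenerator γ)]
        (𝔭 : HeightOneSpectrum (𝓞 K)), ((3 : ℕ) : 𝓞 K) ∈ 𝔭.asIdeal →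
        𝔭.asIdeal.ramificationIdx (𝓞 ℚ) = 1 → 𝔭.asIdeal.inertiaDeg (𝓞 ℚ) = 1 →
        ∀ (𝔭' : HeightOneSpectrum (𝓞 K)), ((3 : ℕ) : 𝓞 K) ∈ 𝔭'.asIdeal → 𝔭' ≠ 𝔭 →
        Module.IsTorsion (IwasawaAlgebra 3) (AcSelmer.XAc (W'.baseChange K) 3 κ 𝔭' ∅ γ) ∧
          ∃ g' : UnrSeries 3,
            (AcSelmer.XAc.charIdeal (W'.baseChange K) 3 κ 𝔭' ∅ γ).map (PowerSeries.map (toUnr 3)) =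
              Ideal.span {g'} ∧
            ∃ i : ℕ, ‖((PowerSeries.coeff i g' : unrIntegers 3) : ℂ_[3])‖ = 1)
    (W' : WeierstrassCurve ℚ) [W'.IsElliptic] [W'.IsGloballyMinimal] (N' : ℕ) [NeZero N']
    (K : Type) [Field K] [NumberField K] (Dt' : ModularParametrizationData W' N')
    (hadd : ¬ Addv W' 3) (hsurj : W'.HasSurjectiveModNGaloisRep 3) (hN : W'.conductorNorm ℤ = N')
    (hK : IsImaginaryQuadratic K) (hH : SatisfiesHeegnerHypothesis N' K)
    (hodd : Odd (NumberField.discr K))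
    (κ : ZpExtension K 3) (hκ : κ.IsAnticyclotomic) (γ : absoluteGaloisGroup K)
    [Fact (κ.IsTopGenerator γ)]
    (𝔭 : HeightOneSpectrum (𝓞 K)) (h𝔭 : ((3 : ℕ) : 𝓞 K) ∈ 𝔭.asIdeal)
    (he : 𝔭.asIdeal.ramificationIdx (𝓞 ℚ) = 1) (hf : 𝔭.asIdeal.inertiaDeg (𝓞 ℚ) = 1)
    (𝔭' : HeightOneSpectrum (𝓞 K)) (h𝔭' : ((3 : ℕ) : 𝓞 K) ∈ 𝔭'.asIdeal) (hne : 𝔭' ≠ 𝔭) :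
    Module.IsTorsion (IwasawaAlgebra 3) (AcSelmer.XAc (W'.baseChange K) 3 κ 𝔭' ∅ γ) ∧
      ∃ g' : UnrSeries 3,
        (AcSelmer.XAc.charIdeal (W'.baseChange K) 3 κ 𝔭' ∅ γ).map (PowerSeries.map (toUnr 3)) =
          Ideal.span {g'} ∧
        ∃ i : ℕ, ‖((PowerSeries.coeff i g' : unrIntegers 3) : ℂ_[3])‖ = 1 := by
  by_cases hgood : W'.HasGoodReductionAtPrime 3
  · by_cases hss : (3 : ℤ) ∣ W'.frobeniusTrace 3
    · exact hC W' N' K Dt' ⟨hgood, by exact_mod_cast hss⟩ hsurj hN hK hH hodd κ hκ γ 𝔭 h𝔭 he hf 𝔭' h𝔭'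
        hne
    · exact twinAlgMu_of_goodOrd_of_bcs h421 h422 W' N' K Dt' ⟨hgood, by exact_mod_cast hss⟩ hsurj hK hH
        hodd κ hκ γ 𝔭 h𝔭 he hf 𝔭' h𝔭' hne
  · have hmult : W'.HasMultiplicativeReductionAtPrime 3 := by
      by_contra h
      exact hadd ⟨hgood, h⟩
    exact hB W' N' K Dt' hmult hsurj hN hK hH hodd κ hκ γ 𝔭 h𝔭 he hf 𝔭' h𝔭' hne


/-! ## The kernel's twins: `TwinAlgMuZeroAtThree` is needed only on buckets B_très and C₀

kernel_rat⁺ (`ToricKernelAtThreeApZeroOddRationalTwinMuOfPrint`, 24256) evaluates its twin packages only at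
twins that are good ORDINARY, or MULTIPLICATIVE TRÈS RAMIFIÉ (`3 ∤ v₃(Δ_min)`, after the resupply
`PeuRamifieMultTwinResupplyAtThree`), or GOOD SUPERSINGULAR with `a₃ = 0` (after `GoodSSApZeroTwinSupplyAtThree`),
always with `d_K` odd (kernel⁵'s trichotomy `bsdp_three_of_defectPT_of_degreeBucketsTR_odd`). On such a twin the
conclusion of `TwinAlgMuZeroAtThree` follows from the kernel's OWN binders `YanZhuMainConjectureInput` and
`TwinMuZeroAtThree` (bucket A, previous file §4) plus the two research clauses B_très and C₀ below — the
honest residue of item 24254 on the deciding chain. -/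

/-- **`TwinAlgMuZeroAtThree` at a kernel twin ⟸ Yan–Zhu 5.7 (1) ∧ `TwinMuZeroAtThree` ∧ B_très ∧ C₀.** In the
kernel's context (wild `W` of class O6 with `ρ̄_{W,3}` onto and analytic rank one; twin `W′` with
`W′[3] ≃ W[3]`, not additive at `3`, off the peu-ramifié multiplicative locus and with `a₃ = 0` if good
supersingular; Heegner `K` for both conductors, `3` split, `d_K` odd) the conclusion of `TwinAlgMuZeroAtThree`
holds given the clauses `hB` (multiplicative très ramifié twins) and `hC` (good supersingular `a₃ = 0` twins)
— binder order of kernel⁵'s `hB`/`hS0`. CONDITIONAL on `h57`; `hmu`, `hB`, `hC` are hypotheses.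
[cite: YanZhu2024MainConjNonCM, Thm. 5.7 (1) (§5.2; J. Algebra 693 (2026))] -/
theorem twinAlgMu_of_kernelTwin_of_yanZhu_of_twinMuZero (h57 : YanZhuMainConjectureInput)
    (hmu : TwinMuZeroAtThree)
    (hB : ∀ (W' : WeierstrassCurve ℚ) [W'.IsElliptic] [W'.IsGloballyMinimal] (N' : ℕ) [NeZero N']
      (K : Type) [Field K] [NumberField K] (Dt' : ModularParametrizationData W' N'),
      Mult W' 3 → W'.HasSurjectiveModNGaloisRep 3 → W'.conductorNorm ℤ = N' → IsImaginaryQuadratic K →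
      SatisfiesHeegnerHypothesis N' K → Odd (NumberField.discr K) → ¬ 3 ∣ padicValInt 3 W'.minimalDiscriminantInt →
      ∀ (κ : ZpExtension K 3), κ.IsAnticyclotomic → ∀ (γ : absoluteGaloisGroup K) [Fact (κ.IsTopGenerator γ)]
        (𝔭 : HeightOneSpectrum (𝓞 K)), ((3 : ℕ) : 𝓞 K) ∈ 𝔭.asIdeal →
        𝔭.asIdeal.ramificationIdx (𝓞 ℚ) = 1 → 𝔭.asIdeal.inertiaDeg (𝓞 ℚ) = 1 →
        ∀ (𝔭' : HeightOneSpectrum (𝓞 K)), ((3 : ℕ) : 𝓞 K) ∈ 𝔭'.asIdeal → 𝔭' ≠ 𝔭 →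
        Module.IsTorsion (IwasawaAlgebra 3) (AcSelmer.XAc (W'.baseChange K) 3 κ 𝔭' ∅ γ) ∧
          ∃ g' : UnrSeries 3,
            (AcSelmer.XAc.charIdeal (W'.baseChange K) 3 κ 𝔭' ∅ γ).map (PowerSeries.map (toUnr 3)) =
              Ideal.span {g'} ∧
            ∃ i : ℕ, ‖((PowerSeries.coeff i g' : unrIntegers 3) : ℂ_[3])‖ = 1)
    (hC : ∀ (W' : WeierstrassCurve ℚ) [W'.IsElliptic] [W'.IsGloballyMinimal] (N' : ℕ) [NeZero N']
      (K : Type) [Field K] [NumberField K] (Dt' : ModularParametrizationData W' N'),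
      GoodSS W' 3 → W'.frobeniusTrace 3 = 0 → W'.HasSurjectiveModNGaloisRep 3 → W'.conductorNorm ℤ = N' →
      IsImaginaryQuadratic K → SatisfiesHeegnerHypothesis N' K → Odd (NumberField.discr K) →
      ∀ (κ : ZpExtension K 3), κ.IsAnticyclotomic → ∀ (γ : absoluteGaloisGroup K) [Fact (κ.IsTopGenerator γ)]
        (𝔭 : HeightOneSpectrum (𝓞 K)), ((3 : ℕ) : 𝓞 K) ∈ 𝔭.asIdeal →
        𝔭.asIdeal.ramificationIdx (𝓞 ℚ) = 1 → 𝔭.asIdeal.inertiaDeg (𝓞 ℚ) = 1 →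
        ∀ (𝔭' : HeightOneSpectrum (𝓞 K)), ((3 : ℕ) : 𝓞 K) ∈ 𝔭'.asIdeal → 𝔭' ≠ 𝔭 →
        Module.IsTorsion (IwasawaAlgebra 3) (AcSelmer.XAc (W'.baseChange K) 3 κ 𝔭' ∅ γ) ∧
          ∃ g' : UnrSeries 3,
            (AcSelmer.XAc.charIdeal (W'.baseChange K) 3 κ 𝔭' ∅ γ).map (PowerSeries.map (toUnr 3)) =
              Ideal.span {g'} ∧
            ∃ i : ℕ, ‖((PowerSeries.coeff i g' : unrIntegers 3) : ℂ_[3])‖ = 1)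
    (W : WeierstrassCurve ℚ) [W.IsElliptic] [W.IsGloballyMinimal]
    (W' : WeierstrassCurve ℚ) [W'.IsElliptic] [W'.IsGloballyMinimal] (N N' : ℕ) [NeZero N] [NeZero N']
    (K : Type) [Field K] [NumberField K] (Dt : ModularParametrizationData W N)
    (Dt' : ModularParametrizationData W' N')
    (hO6 : Additive.ClassO6 W 3) (hsurj : W.HasSurjectiveModNGaloisRep 3) (hr : W.analyticRank = 1)
    (hN : W.conductorNorm ℤ = N) (hcong : O6.ModPCongruent W' W 3)
    (hadd : ¬ Addv W' 3) (htres : Mult W' 3 → ¬ 3 ∣ padicValInt 3 W'.minimalDiscriminantInt)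
    (ha0 : GoodSS W' 3 → W'.frobeniusTrace 3 = 0)
    (hsurj' : W'.HasSurjectiveModNGaloisRep 3) (hN' : W'.conductorNorm ℤ = N')
    (hK : IsImaginaryQuadratic K) (hH : SatisfiesHeegnerHypothesis N K)
    (hH' : SatisfiesHeegnerHypothesis N' K) (hodd : Odd (NumberField.discr K))
    (κ : ZpExtension K 3) (hκ : κ.IsAnticyclotomic) (γ : absoluteGaloisGroup K)
    [Fact (κ.IsTopGenerator γ)]
    (𝔭 : HeightOneSpectrum (𝓞 K)) (h𝔭 : ((3 : ℕ) : 𝓞 K) ∈ 𝔭.asIdeal)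
    (he : 𝔭.asIdeal.ramificationIdx (𝓞 ℚ) = 1) (hf : 𝔭.asIdeal.inertiaDeg (𝓞 ℚ) = 1)
    (𝔭' : HeightOneSpectrum (𝓞 K)) (h𝔭' : ((3 : ℕ) : 𝓞 K) ∈ 𝔭'.asIdeal) (hne : 𝔭' ≠ 𝔭) :
    Module.IsTorsion (IwasawaAlgebra 3) (AcSelmer.XAc (W'.baseChange K) 3 κ 𝔭' ∅ γ) ∧
      ∃ g' : UnrSeries 3,
        (AcSelmer.XAc.charIdeal (W'.baseChange K) 3 κ 𝔭' ∅ γ).map (PowerSeries.map (toUnr 3)) =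
          Ideal.span {g'} ∧
        ∃ i : ℕ, ‖((PowerSeries.coeff i g' : unrIntegers 3) : ℂ_[3])‖ = 1 := by
  by_cases hgood : W'.HasGoodReductionAtPrime 3
  · by_cases hss : (3 : ℤ) ∣ W'.frobeniusTrace 3
    · have hS : GoodSS W' 3 := ⟨hgood, by exact_mod_cast hss⟩
      exact hC W' N' K Dt' hS (ha0 hS) hsurj' hN' hK hH' hodd κ hκ γ 𝔭 h𝔭 he hf 𝔭' h𝔭' hne
    · exact twinAlgMu_of_goodOrd_of_yanZhu_of_twinMuZero h57 hmu W W' N N' K Dt Dt' hO6 hsurj hr hN hcong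
        ⟨hgood, by exact_mod_cast hss⟩ hsurj' hN' hK hH hH' hodd κ hκ γ 𝔭 h𝔭 he hf 𝔭' h𝔭' hne
  · have hmult : W'.HasMultiplicativeReductionAtPrime 3 := by
      by_contra h
      exact hadd ⟨hgood, h⟩
    exact hB W' N' K Dt' hmult hsurj' hN' hK hH' hodd (htres hmult) κ hκ γ 𝔭 h𝔭 he hf 𝔭' h𝔭' hne

/-! ## The two restate candidates of 24254 (pen pss3x g8 08:55/08:58Z, director (367)/(368): next generation)

R1 = the live text + `Odd (NumberField.discr K)`; R2 = R1 with `¬ Addv W′ 3` replaced by the kernel's twin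
buckets `(Mult W′ 3 ∧ 3 ∤ v₃(Δ_min W′)) ∨ (GoodSS W′ 3 ∧ a₃(W′) = 0)`. Both are spelled out VERBATIM below
(texts `HOME/bsd-wall-pss3x/g8/rk6v3/twinalg_odd_1l.txt`, `twinalg_min_1l.txt`), never by name, so this file
survives either restate: R1 ⟸ BCS 2025 ∧ B ∧ C (`r1Text_of_bcs_of_buckets`), and R2 feeds the kernel's twins
together with `YanZhuMainConjectureInput` + `TwinMuZeroAtThree` (`twinAlgMu_of_kernelTwin_of_yanZhu_of_twinMuZero_of_r2Text`). -/

/-- **R1 ⟸ `BCSHowardDivisibilityInput ∧ BCSMuZeroInput ∧ B ∧ C`**: the odd-discriminant restate candidate R1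
of 24254 (text verbatim) from the two BCS 2025 aliases (bucket A) and the research clauses B (multiplicative
twins) and C (good-supersingular twins). One line on `twinAlgMu_of_not_addv_of_odd_of_buckets`.
[cite: BurungaleCastellaSkinner2025, Thm. 4.2.1 (b) and Prop. 4.2.2 (§4.2, pp. 8–9 of arXiv:2405.00270v2)] -/
theorem r1Text_of_bcs_of_buckets (h421 : BCSHowardDivisibilityInput) (h422 : BCSMuZeroInput)
    (hB : ∀ (W' : WeierstrassCurve ℚ) [W'.IsElliptic] [W'.IsGloballyMinimal] (N' : ℕ) [NeZero N']
      (K : Type) [Field K] [NumberField K] (Dt' : ModularParametrizationData W' N'),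
      Mult W' 3 → W'.HasSurjectiveModNGaloisRep 3 → W'.conductorNorm ℤ = N' → IsImaginaryQuadratic K →
      SatisfiesHeegnerHypothesis N' K → Odd (NumberField.discr K) →
      ∀ (κ : ZpExtension K 3), κ.IsAnticyclotomic → ∀ (γ : absoluteGaloisGroup K) [Fact (κ.IsTopGenerator γ)]
        (𝔭 : HeightOneSpectrum (𝓞 K)), ((3 : ℕ) : 𝓞 K) ∈ 𝔭.asIdeal →
        𝔭.asIdeal.ramificationIdx (𝓞 ℚ) = 1 → 𝔭.asIdeal.inertiaDeg (𝓞 ℚ) = 1 →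
        ∀ (𝔭' : HeightOneSpectrum (𝓞 K)), ((3 : ℕ) : 𝓞 K) ∈ 𝔭'.asIdeal → 𝔭' ≠ 𝔭 →
        Module.IsTorsion (IwasawaAlgebra 3) (AcSelmer.XAc (W'.baseChange K) 3 κ 𝔭' ∅ γ) ∧
          ∃ g' : UnrSeries 3,
            (AcSelmer.XAc.charIdeal (W'.baseChange K) 3 κ 𝔭' ∅ γ).map (PowerSeries.map (toUnr 3)) =
              Ideal.span {g'} ∧
            ∃ i : ℕ, ‖((PowerSeries.coeff i g' : unrIntegers 3) : ℂ_[3])‖ = 1)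
    (hC : ∀ (W' : WeierstrassCurve ℚ) [W'.IsElliptic] [W'.IsGloballyMinimal] (N' : ℕ) [NeZero N']
      (K : Type) [Field K] [NumberField K] (Dt' : ModularParametrizationData W' N'),
      GoodSS W' 3 → W'.HasSurjectiveModNGaloisRep 3 → W'.conductorNorm ℤ = N' → IsImaginaryQuadratic K →
      SatisfiesHeegnerHypothesis N' K → Odd (NumberField.discr K) →
      ∀ (κ : ZpExtension K 3), κ.IsAnticyclotomic → ∀ (γ : absoluteGaloisGroup K) [Fact (κ.IsTopGenerator γ)]
        (𝔭 : HeightOneSpectrum (𝓞 K)), ((3 : ℕ) : 𝓞 K) ∈ 𝔭.asIdeal →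
        𝔭.asIdeal.ramificationIdx (𝓞 ℚ) = 1 → 𝔭.asIdeal.inertiaDeg (𝓞 ℚ) = 1 →
        ∀ (𝔭' : HeightOneSpectrum (𝓞 K)), ((3 : ℕ) : 𝓞 K) ∈ 𝔭'.asIdeal → 𝔭' ≠ 𝔭 →
        Module.IsTorsion (IwasawaAlgebra 3) (AcSelmer.XAc (W'.baseChange K) 3 κ 𝔭' ∅ γ) ∧
          ∃ g' : UnrSeries 3,
            (AcSelmer.XAc.charIdeal (W'.baseChange K) 3 κ 𝔭' ∅ γ).map (PowerSeries.map (toUnr 3)) =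
              Ideal.span {g'} ∧
            ∃ i : ℕ, ‖((PowerSeries.coeff i g' : unrIntegers 3) : ℂ_[3])‖ = 1)
    : ∀ (W' : WeierstrassCurve ℚ) [W'.IsElliptic] [W'.IsGloballyMinimal] (N' : ℕ) [NeZero N'] (K : Type) [Field K] [NumberField K] (Dt' : Literature.NumberTheory.EllipticCurves.ModularForms.ModularParametrizationData W' N'), ¬ Literature.NumberTheory.EllipticCurves.Rank1Residual.Addv W' 3 → W'.HasSurjectiveModNGaloisRep 3 → W'.conductorNorm ℤ = N' → Literature.NumberTheory.EllipticCurves.IsImaginaryQuadratic K → Literature.NumberTheory.EllipticCurves.SatisfiesHeegnerHypothesis N' K → Odd (NumberField.discr K) → ∀ (κ : Literature.NumberTheory.EllipticCurves.ZpExtension K 3), κ.IsAnticyclotomic → ∀ (γ : Field.absoluteGaloisGroup K) [Fact (κ.IsTopGenerator γ)] (𝔭 : IsDedekindDomain.HeightOneSpectrum (NumberField.RingOfIntegers K)), ((3 : ℕ) : NumberField.RingOfIntegers K) ∈ 𝔭.asIdeal → 𝔭.asIdeal.ramificationIdx (NumberField.RingOfIntegers ℚ) = 1 → 𝔭.asIdeal.inertiaDeg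 (NumberField.RingOfIntegers ℚ) = 1 → ∀ (𝔭' : IsDedekindDomain.HeightOneSpectrum (NumberField.RingOfIntegers K)), ((3 : ℕ) : NumberField.RingOfIntegers K) ∈ 𝔭'.asIdeal → 𝔭' ≠ 𝔭 → Module.IsTorsion (Literature.NumberTheory.EllipticCurves.IwasawaAlgebra 3) (Summit.BirchSwinnertonDyer.Rank1Residual.X11b.AcSelmer.XAc (W'.baseChange K) 3 κ 𝔭' ∅ γ) ∧ ∃ g' : Literature.NumberTheory.EllipticCurves.UnrSeries 3, (Summit.BirchSwinnertonDyer.Rank1Residual.X11b.AcSelmer.XAc.charIdeal (W'.baseChange K) 3 κ 𝔭' ∅ γ).map (PowerSeries.map (Summit.BirchSwinnertonDyer.Rank1Residual.X11b.Halves.toUnr 3)) = Ideal.span {g'} ∧ ∃ i : ℕ, ‖((PowerSeries.coeff i g' : Literature.NumberTheory.EllipticCurves.unrIntegers 3) : ℂ_[3])‖ = 1 := by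
  intro W' _ _ N' _ K _ _ Dt' hadd hsurj hN hK hH hodd κ hκ γ _ 𝔭 h𝔭 he hf 𝔭' h𝔭' hne
  exact twinAlgMu_of_not_addv_of_odd_of_buckets h421 h422 hB hC W' N' K Dt' hadd hsurj hN hK hH hodd κ hκ γ 𝔭
    h𝔭 he hf 𝔭' h𝔭' hne

/-- **The kernel's twins under R2.** With the kernel-bucket restate candidate R2 of 24254 (text verbatim) as
the ONLY research input, plus the kernel's own binders `YanZhuMainConjectureInput` and `TwinMuZeroAtThree`, the
conclusion of `TwinAlgMuZeroAtThree` holds at every twin the kernel meets (good-ordinary ∨ multiplicative très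
ramifié ∨ good-supersingular `a₃ = 0`; `d_K` odd) — the drop-in for the three pointwise calls of kernel_rat⁺'s
trichotomy, i.e. the kernel-side confirmation that 24256 tolerates R2. CONDITIONAL on `h57`; `hmu`, `hR2`
hypotheses. [cite: YanZhu2024MainConjNonCM, Thm. 5.7 (1) (§5.2; J. Algebra 693 (2026))] -/
theorem twinAlgMu_of_kernelTwin_of_yanZhu_of_twinMuZero_of_r2Text (h57 : YanZhuMainConjectureInput)
    (hmu : TwinMuZeroAtThree)
    (hR2 : ∀ (W' : WeierstrassCurve ℚ) [W'.IsElliptic] [W'.IsGloballyMinimal] (N' : ℕ) [NeZero N'] (K : Type) [Field K] [NumberField K] (Dt' : Literature.NumberTheory.EllipticCurves.ModularForms.ModularParametrizationData W' N'), (Literature.NumberTheory.EllipticCurves.Rank1Residual.Mult W' 3 ∧ ¬ 3 ∣ padicValInt 3 W'.minimalDiscriminantInt ∨ Literature.NumberTheory.EllipticCurves.Rank1Residual.GoodSS W' 3 ∧ W'.frobeniusTrace 3 = 0) → W'.HasSurjectiveModNGaloisRep 3 → W'.conductorNorm ℤ = N' → Literature.NumberTheory.EllipticCurves.IsImaginaryQuadratic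 K → Literature.NumberTheory.EllipticCurves.SatisfiesHeegnerHypothesis N' K → Odd (NumberField.discr K) → ∀ (κ : Literature.NumberTheory.EllipticCurves.ZpExtension K 3), κ.IsAnticyclotomic → ∀ (γ : Field.absoluteGaloisGroup K) [Fact (κ.IsTopGenerator γ)] (𝔭 : IsDedekindDomain.HeightOneSpectrum (NumberField.RingOfIntegers K)), ((3 : ℕ) : NumberField.RingOfIntegers K) ∈ 𝔭.asIdeal → 𝔭.asIdeal.ramificationIdx (NumberField.RingOfIntegers ℚ) = 1 → 𝔭.asIdeal.inertiaDeg (NumberField.RingOfIntegers ℚ) = 1 → ∀ (𝔭' : IsDedekindDomain.HeightOneSpectrum (NumberField.RingOfIntegers K)), ((3 : ℕ) : NumberField.RingOfIntegers K) ∈ 𝔭'.asIdeal → 𝔭' ≠ 𝔭 → Module.IsTorsion (Literature.NumberTheory.EllipticCurves.IwasawaAlgebra 3) (Summit.BirchSwinnertonDyer.Rank1Residual.X11b.AcSelmer.XAc (W'.baseChange K) 3 κ 𝔭' ∅ γ) ∧ ∃ g' : Literature.NumberTheory.EllipticCurves.UnrSeries 3, (Summit.BirchSwinnertonDyer.Rank1Residual.X11b.AcSelmer.XAc.charIdeal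 (W'.baseChange K) 3 κ 𝔭' ∅ γ).map (PowerSeries.map (Summit.BirchSwinnertonDyer.Rank1Residual.X11b.Halves.toUnr 3)) = Ideal.span {g'} ∧ ∃ i : ℕ, ‖((PowerSeries.coeff i g' : Literature.NumberTheory.EllipticCurves.unrIntegers 3) : ℂ_[3])‖ = 1)
    (W : WeierstrassCurve ℚ) [W.IsElliptic] [W.IsGloballyMinimal]
    (W' : WeierstrassCurve ℚ) [W'.IsElliptic] [W'.IsGloballyMinimal] (N N' : ℕ) [NeZero N] [NeZero N']
    (K : Type) [Field K] [NumberField K] (Dt : ModularParametrizationData W N)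
    (Dt' : ModularParametrizationData W' N')
    (hO6 : Additive.ClassO6 W 3) (hsurj : W.HasSurjectiveModNGaloisRep 3) (hr : W.analyticRank = 1)
    (hN : W.conductorNorm ℤ = N) (hcong : O6.ModPCongruent W' W 3)
    (hadd : ¬ Addv W' 3) (htres : Mult W' 3 → ¬ 3 ∣ padicValInt 3 W'.minimalDiscriminantInt)
    (ha0 : GoodSS W' 3 → W'.frobeniusTrace 3 = 0)
    (hsurj' : W'.HasSurjectiveModNGaloisRep 3) (hN' : W'.conductorNorm ℤ = N')
    (hK : IsImaginaryQuadratic K) (hH : SatisfiesHeegnerHypothesis N K)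
    (hH' : SatisfiesHeegnerHypothesis N' K) (hodd : Odd (NumberField.discr K))
    (κ : ZpExtension K 3) (hκ : κ.IsAnticyclotomic) (γ : absoluteGaloisGroup K)
    [Fact (κ.IsTopGenerator γ)]
    (𝔭 : HeightOneSpectrum (𝓞 K)) (h𝔭 : ((3 : ℕ) : 𝓞 K) ∈ 𝔭.asIdeal)
    (he : 𝔭.asIdeal.ramificationIdx (𝓞 ℚ) = 1) (hf : 𝔭.asIdeal.inertiaDeg (𝓞 ℚ) = 1)
    (𝔭' : HeightOneSpectrum (𝓞 K)) (h𝔭' : ((3 : ℕ) : 𝓞 K) ∈ 𝔭'.asIdeal) (hne : 𝔭' ≠ 𝔭) :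
    Module.IsTorsion (IwasawaAlgebra 3) (AcSelmer.XAc (W'.baseChange K) 3 κ 𝔭' ∅ γ) ∧
      ∃ g' : UnrSeries 3,
        (AcSelmer.XAc.charIdeal (W'.baseChange K) 3 κ 𝔭' ∅ γ).map (PowerSeries.map (toUnr 3)) =
          Ideal.span {g'} ∧
        ∃ i : ℕ, ‖((PowerSeries.coeff i g' : unrIntegers 3) : ℂ_[3])‖ = 1 :=
  twinAlgMu_of_kernelTwin_of_yanZhu_of_twinMuZero h57 hmu
    (fun W' _ _ N' _ K _ _ Dt' hmult hsurj hN hK hH hodd htres κ hκ γ _ 𝔭 h𝔭 he hf 𝔭' h𝔭' hne ↦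
      hR2 W' N' K Dt' (Or.inl ⟨hmult, htres⟩) hsurj hN hK hH hodd κ hκ γ 𝔭 h𝔭 he hf 𝔭' h𝔭' hne)
    (fun W' _ _ N' _ K _ _ Dt' hss ha0 hsurj hN hK hH hodd κ hκ γ _ 𝔭 h𝔭 he hf 𝔭' h𝔭' hne ↦
      hR2 W' N' K Dt' (Or.inr ⟨hss, ha0⟩) hsurj hN hK hH hodd κ hκ γ 𝔭 h𝔭 he hf 𝔭' h𝔭' hne)
    W W' N N' K Dt Dt' hO6 hsurj hr hN hcong hadd htres ha0 hsurj' hN' hK hH hH' hodd κ hκ γ 𝔭 h𝔭 he hf 𝔭' h𝔭'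
    hne

end Summit.BirchSwinnertonDyer.BirchSwinnertonDyer.Theorems.UniversalToricDescentTwinAlgMu

end
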